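import Summits.ABC.IUTFork.Repair.RHHullCellSlice
import HarnessLib

/-!
# R-H ROUND 3, AXIS D2 (HEIGHT SCALING), object class «slice»: the licensed initial segment `{1, …, J_w}` of the exact U2 cell SHRINKS LIKE
# `1/height` and is EXTINCT (`J_w = 1`, zero demand mass) above a conductor-type multiple of the tabulated height — kernel face of D2-EXP-1

abc-iut cell, rung LADDER-ABC:A2.RESCUE.H; round-3 axis D2 seat abc-iut-rh2-q2-hull (D2-EXP-1, KEY `wake/KEY-abc-iut-rh2-q2-hull-D2-EXP-1.md`;
21-frontier 11:38:40Z / 11:44:07Z, D-0130). PROOF-ONLY file (0 definitions, 0 `Prop` facts): integer arithmetic about the typed exact cell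
`RH.DiffPricedHull.HullCellδ e m j δ r_in r_out :⟺ e·⌊(j²·m − j·δ − (j+1)·r_in)/e⌋ ≤ m − (j+1)·r_out` (row 4 = Σ₄ = the licence cells EXACTLY,
abc-iut-rh2-q2-eq `RHSigmaStrataEq.sigmaNu_eq_licenceCells`; slice = initial segment by abc-iut-rh2-w-2's `RHHullCellSlice.exists_sliceBoundary`).

THE QUESTION (D0121-FINAL-1200Z item (1)(d)/(e), `plan/rescue/R-H/ROUND3/`): under the HEIGHT SCALING OF RECORD — places, `l`, `e_w`, `δ_w = D`,
`R_in`, `R_out` FIXED (conductor-type data) and the q-depth scaled `m_q ↦ t·m_q` (abc-iut-rh-kit-2 PASS 22b `scaleA.py`, `h(t) = t·h(1)`) — what is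
the recovered-fraction exponent in the height of the class «slice» (kept fraction `μ_slice(t) = Σ_w ω_w·S(J_w(t))/S(l⋆)`, `S(n) = Σ_{j≤n}(j²−1) =
n(n−1)(2n+5)/6`, abc-iut-rh2-w-1 `RHCellWeights.sum_range_sqSubOne`; = MIN-SLICE (iii) column `mu4`, FINAL item (5) rung r0)?

WHAT IS PROVED (namespace `Summit.ABC.IUTFork.Repair.RH.HullCellSliceHeightScaling`; structural hypotheses of a local field as in `RHHullCellSlice`:
`0 < e`, `e − 1 ≤ δ`, `r_out ≤ r_in`, `0 ≤ m`; write `G := r_in − r_out ≥ 0`, `A := δ + G + (e − 1)`, `b := δ + G` — CONDUCTOR-TYPE, depth-free):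
* §1 THE `1/height` LAW FOR THE BOUNDARY, two-sided and floor-free: a licensed label `J ≥ 1` has `(J − 1)·m ≤ A` (`sub_one_mul_le_of_hullCellδ`);
  every label `j ≥ 1` with `j·m ≤ b` is licensed (`hullCellδ_of_mul_le`), so the slice boundary `J` of `exists_sliceBoundary` satisfies
  `min L ⌊b/m⌋ ≤ J` and `(J − 1)·m ≤ A` (`boundary_bracket`). At the scaled depth `t·m`: `(J_t − 1)·(t·m) ≤ A`, `min L ⌊b/(t·m)⌋ ≤ J_t`
  (`scaled_boundary_bracket`) — `J_t ≍ b/t`: EXPONENT −1 for the boundary, hence −3 for the demand mass `S(J_t) ~ J_t³/3` (§3).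
* §2 EXTINCTION: `2δ + 3G + (e − 1) < 3m ⟹ ¬ HullCellδ … 2 …` hence `¬ HullCellδ … j …` for every `j ≥ 2` (`not_hullCellδ_of_two_le_of_lt`): the
  place's slice is `{1}` exactly (`hullCellδ_iff_eq_one_of_lt`), and label `1` carries ZERO demand (`j² − 1 = 0`). Scaled: for every integer
  `t ≥ (2δ + 3G + (e−1))/(3m) + 1` (`m ≥ 1`) the slice at depth `t·m` is `{1}` (`slice_eq_one_eventually`) — **the class «slice» recovers EXACTLY
  NOTHING above a conductor-type multiple `t₁ ≤ A/m + 1` of the tabulated height**; conversely `3m ≤ 2δ + 3G ⟹` label `2` is licensed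
  (`hullCellδ_two_of_le`): the floor-free bracket `[t_nec, t_suf]` of the D2-SLICE tables. Label-2 licence is NOT monotone in the depth in general
  (`flicker_row`: `e = 390, δ = 389, R_in = 5, R_out = −307, m_q = 30`, depth `630` OFF, `660` ON, `690` OFF — a genuine FREY133 place `p = 83` at `t = 21, 22, 23`), which is why
  the tables scan `t` below `t_suf` instead of bisecting.
* §3 CUBIC MASS BOUND: `(J − 1)·x ≤ A`, `1 ≤ J`, `0 ≤ x` give `J(J−1)(2J+5)·x³ ≤ A·(A + x)·(2A + 7x)` (`six_sliceDemand_mul_cube_le`), i.e. with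
  `x = t·m`: `6·S(J_t) ≤ (A/x)(A/x + 1)(2A/x + 7)` — `S(J_t) ≤ (A³/3)·(t·m)⁻³·(1 + O(t·m/A))`, the `t⁻³` law for the licensed demand COUNT, and the
  kept fraction `S(J_t)/S(l⋆) ≤ A(A + tm)(2A + 7tm)/((tm)³·l⋆(l⋆−1)(2l⋆+5))` (cf. `RHCellWeights` §1c «slice fraction, cubic law»).
* §3b THE ∀-CONSTANT (RULING R81 (G1)): `6·S(J) ≤ 18(J−1)³` (`J ≥ 2`), hence `(J−1)x ≤ A ⟹ J(J−1)(2J+5)x³ ≤ 18A³`, i.e. `S(J_t) ≤ 3(A/(tm))³`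
  at EVERY `t ≥ 1` (`six_sliceDemand_mul_cube_le_cube`, `…_of_hullCellδ`): `μ_slice(t) ≤ C_A·t⁻³`, `C_A = 3Σ_w ω_w(A_w/m_q)³/S(l⋆)` (tst-1's constant).
* §4 BED WITNESS ROWS by `decide` (the three heavy places of `RHHullCellSlice.rows_worked_example`, R-W WINDOW-TABLE v4.11 integers, at scaled
  depths): HEX `λ₈ @ l = 11`, `p = 7` (`e 165, δ 164, R_in 28, R_out −281, m_q 120`): `J = 4, 2, 2, 1` at `t = 1, 2, 3, 4` — extinct from `t = 4`
  (`t_nec = 3`, `t_suf = 4`); FREY `2⁵67⁸… @ 13`, `p = 3` WILD (`390, 779, 196, −1707, 660`): `J = 4, 2, 2, 1` — extinct from `t = 4`; `p = 53`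
  (`65, 64, 2, −12, 30`): `J = 3, 2, 1` — extinct from `t = 3`; and the flicker row above.
NUMBERS OF RECORD (not proved here; engine `d2slice.py` 936b145b5e2a7a97 = PASS 22b conventions verbatim, cross-checked cell for cell against the
two-engine grid j267263; `HOME/abc-iut-rh2-q2-hull/D2-SLICE/`): extinction height `t₁·h(1)` ≤ 531,496 nats on 216/216 (v4.11) + 565/565 (v4.16)
tabulated data (FREY133 median 8,470 · HEX79 9,265 · FREY482 31,000 nats) — below the content cut 4.7·10⁶ and the L-window 7.1·10⁸ nats on every
datum; staircase fit of `log μ_slice` vs `log t` median −2.73 / −2.68 / −2.81 (→ −3 as `l⋆` grows: `l ≥ 201` median −2.84).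
HONEST FRAMING: integer identities about OUR typed cell under OUR height-scaling convention; nothing here asserts that abc is proved or refuted, or
that [IUTchIII] Cor. 3.12 holds or fails at any datum, or takes a side on any author; typed ≠ proved; computed ≠ proved.
[claim: Mochizuki2012, status: disputed] for every IUT locution. [cite: Mochizuki2012, IUTchIII Cor. 3.12 p. 173–174; IUTchIV Prop. 1.2 (i)(ii) p. 10,
Thm. 1.10 p. 24–28] [cite: SerreLocalFields1979, Ch. III §6 Prop. 13]
-/

namespace Summit.ABC.IUTFork.Repair.RH.HullCellSliceHeightScaling

open Summit.ABC.IUTFork.Repair.RH.DiffPricedHull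
open Summit.ABC.IUTFork.Repair.RH.HullCellSlice

/-! ## §1. The `1/height` law for the slice boundary (floor-free, two-sided) -/

/-- **UPPER HALF: a licensed label `J ≥ 1` has `(J − 1)·m ≤ δ + (r_in − r_out) + (e − 1)`** (`0 < e`, `e − 1 ≤ δ`, `r_out ≤ r_in`; any `m`).
From the necessary floor-free half `(J²−1)m ≤ Jδ + (J+1)(r_in − r_out) + (e−1)` (`linear_of_hullCellδ`): the right side is
`≤ (J+1)·(δ + (r_in − r_out) + (e−1))`, divide by `J + 1 > 0`. This is D0121-FINAL (3)'s «j₀ law `j₀(w) ≤ 1 + (δ_w + G_w + e_w)/m_q`», sharpened by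
`1/m_q` and made a theorem of the exact cell at every local type. [folklore] -/
theorem sub_one_mul_le_of_hullCellδ {e m J δ rin rout : ℤ} (he : 0 < e) (hδ : e - 1 ≤ δ) (hio : rout ≤ rin)
    (hJ : 1 ≤ J) (h : HullCellδ e m J δ rin rout) : (J - 1) * m ≤ δ + (rin - rout) + (e - 1) := by
  have hlin := linear_of_hullCellδ he h
  have h1 : (J + 1) * ((J - 1) * m) ≤ (J + 1) * (δ + (rin - rout) + (e - 1)) := by
    have hX : 0 ≤ rin - rout := by omega
    have hE : 0 ≤ e - 1 := by omega
    nlinarith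
  exact le_of_mul_le_mul_left h1 (by omega)

/-- **LOWER HALF: every label `j ≥ 1` with `j·m ≤ δ + (r_in − r_out)` is licensed** (`0 < e`, `r_out ≤ r_in`, `0 ≤ m`): then
`(j²−1)m ≤ j²m = j·(jm) ≤ j(δ + G) ≤ jδ + (j+1)G`, the sufficient floor-free half (`hullCellδ_of_linear`). [folklore] -/
theorem hullCellδ_of_mul_le {e m j δ rin rout : ℤ} (he : 0 < e) (hio : rout ≤ rin) (hm : 0 ≤ m) (hj : 1 ≤ j)
    (h : j * m ≤ δ + (rin - rout)) : HullCellδ e m j δ rin rout := by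
  refine hullCellδ_of_linear he ?_
  have hX : 0 ≤ rin - rout := by omega
  have h1 : j * (j * m) ≤ j * (δ + (rin - rout)) := mul_le_mul_of_nonneg_left h (by omega)
  nlinarith

/-- **BRACKET FOR THE BOUNDARY.** If `J ≥ 1` is a boundary pair (`HullCellδ` at `J`, `¬ HullCellδ` at `J + 1`; e.g. the slice boundary of
`exists_sliceBoundary` among the labels `≤ L = l⋆`), then for EVERY `L`, `min L ((δ + G)/m) ≤ J` (integer division; `m ≥ 1`) and
`(J − 1)·m ≤ δ + G + (e − 1)`: the boundary is pinned, floor-free,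
between `b/m` and `1 + A/m` with `b = δ + G ≤ A = δ + G + e − 1 ≤ 2b` — SLICE.md's «`j₀ ≈ slope/m_q`» as a two-sided theorem. [folklore] -/
theorem boundary_bracket {e m J δ rin rout : ℤ} (L : ℤ) (he : 0 < e) (hδ : e - 1 ≤ δ) (hio : rout ≤ rin) (hm : 1 ≤ m)
    (hJ : 1 ≤ J) (hin : HullCellδ e m J δ rin rout) (hoff : ¬ HullCellδ e m (J + 1) δ rin rout) :
    min L ((δ + (rin - rout)) / m) ≤ J ∧ (J - 1) * m ≤ δ + (rin - rout) + (e - 1) := by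
  refine ⟨?_, sub_one_mul_le_of_hullCellδ he hδ hio hJ hin⟩
  -- the label `j₀ := min L ⌊b/m⌋` has `j₀·m ≤ b`; if `j₀ ≤ 0` the claim is trivial, else it is licensed hence `≤ J`
  set b : ℤ := δ + (rin - rout) with hb
  have hbm : (b / m) * m ≤ b := Int.ediv_mul_le b (by omega)
  by_cases hj0 : min L (b / m) ≤ 0
  · omega
  · push Not at hj0
    have hj1 : 1 ≤ min L (b / m) := by omega
    have hle : min L (b / m) * m ≤ b := by
      have h1 : min L (b / m) * m ≤ (b / m) * m := mul_le_mul_of_nonneg_right (min_le_right _ _) (by omega)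
      exact h1.trans hbm
    have hcell : HullCellδ e m (min L (b / m)) δ rin rout := hullCellδ_of_mul_le he hio (by omega) hj1 hle
    -- licensed labels `≤ L` are `≤ J` (one boundary pair pins the column)
    by_contra hlt
    push Not at hlt
    exact not_hullCellδ_mono he hδ hio (by omega) (by omega) (show J + 1 ≤ min L (b / m) by omega) hoff hcell

/-- **THE SCALED FORM (height scaling of record `m ↦ t·m`, `t ≥ 1`).** At depth `t·m` the slice boundary `J_t` satisfies
`min L ((δ + G)/(t·m)) ≤ J_t` and `(J_t − 1)·(t·m) ≤ δ + G + (e − 1)`: **`t·(J_t − 1)` is bounded by the CONDUCTOR-TYPE constant `A/m` and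
`t·J_t ≥ b/m − t` — the boundary decays exactly like `1/t` until it reaches `1`** (exponent −1; the demand mass `S(J_t) ~ J_t³/3` then carries
exponent −3, §3). [folklore] -/
theorem scaled_boundary_bracket {e m t J δ rin rout : ℤ} (L : ℤ) (he : 0 < e) (hδ : e - 1 ≤ δ) (hio : rout ≤ rin) (hm : 1 ≤ m)
    (ht : 1 ≤ t) (hJ : 1 ≤ J) (hin : HullCellδ e (t * m) J δ rin rout) (hoff : ¬ HullCellδ e (t * m) (J + 1) δ rin rout) :
    min L ((δ + (rin - rout)) / (t * m)) ≤ J ∧ (J - 1) * (t * m) ≤ δ + (rin - rout) + (e - 1) :=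
  boundary_bracket L he hδ hio (by nlinarith) hJ hin hoff

/-! ## §2. Extinction: above a conductor-type multiple of the tabulated depth the slice is `{1}` -/

/-- **Label `2` is OFF once `2δ + 3(r_in − r_out) + (e − 1) < 3m`** (`0 < e`): the demand `(2²−1)·m = 3m` beats the floor-free price ceiling.
[folklore] -/
theorem not_hullCellδ_two_of_lt {e m δ rin rout : ℤ} (he : 0 < e) (h : 2 * δ + 3 * (rin - rout) + (e - 1) < 3 * m) :
    ¬ HullCellδ e m 2 δ rin rout :=
  not_hullCellδ_of_linear_lt he (by linarith)

/-- **EXTINCTION: `2δ + 3(r_in − r_out) + (e − 1) < 3m ⟹ ¬ HullCellδ … j …` for every label `j ≥ 2`** (`0 < e`, `e − 1 ≤ δ`, `r_out ≤ r_in`,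
`0 ≤ m`; downward closure `not_hullCellδ_mono`). The place's licensed slice is `{1}`, whose demand `1² − 1 = 0`: the class «slice» keeps NOTHING
at this place. [folklore] -/
theorem not_hullCellδ_of_two_le_of_lt {e m j δ rin rout : ℤ} (he : 0 < e) (hδ : e - 1 ≤ δ) (hio : rout ≤ rin) (hm : 0 ≤ m)
    (h : 2 * δ + 3 * (rin - rout) + (e - 1) < 3 * m) (hj : 2 ≤ j) : ¬ HullCellδ e m j δ rin rout :=
  not_hullCellδ_mono he hδ hio hm (by norm_num) hj (not_hullCellδ_two_of_lt he h)

/-- **The slice is EXACTLY `{1}`**: under `2δ + 3G + (e−1) < 3m`, for every label `j ≥ 1`, `HullCellδ … j … ↔ j = 1` (label `1` is always IN,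
`hullCellδ_one`). [folklore] -/
theorem hullCellδ_iff_eq_one_of_lt {e m j δ rin rout : ℤ} (he : 0 < e) (hδ : e - 1 ≤ δ) (hio : rout ≤ rin) (hm : 0 ≤ m)
    (h : 2 * δ + 3 * (rin - rout) + (e - 1) < 3 * m) (hj : 1 ≤ j) : HullCellδ e m j δ rin rout ↔ j = 1 := by
  constructor
  · intro hc
    by_contra hne
    exact not_hullCellδ_of_two_le_of_lt he hδ hio hm h (by omega) hc
  · rintro rfl
    exact hullCellδ_one he hδ hio

/-- **Converse side of the bracket: `3m ≤ 2δ + 3(r_in − r_out) ⟹` label `2` is licensed** (`0 < e`; sufficient floor-free half). So the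
extinction depth of label `2` lies in the floor-free bracket `((2δ + 3G)/3, (2δ + 3G + e − 1)/3]`. [folklore] -/
theorem hullCellδ_two_of_le {e m δ rin rout : ℤ} (he : 0 < e) (h : 3 * m ≤ 2 * δ + 3 * (rin - rout)) :
    HullCellδ e m 2 δ rin rout :=
  hullCellδ_of_linear he (by linarith)

/-- **EXTINCTION UNDER THE HEIGHT SCALING OF RECORD, eventually in `t`.** With `m ≥ 1` and `t₀ := (2δ + 3(r_in − r_out) + (e − 1))/(3m) + 1`
(integer division): for EVERY integer `t ≥ t₀` and every label `j ≥ 2`, `¬ HullCellδ e (t·m) j δ r_in r_out` — the licensed slice at depth `t·m`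
is `{1}` and its demand mass `Σ_{j ≤ J}(j² − 1)·t·m` is `0`. (`3m·t ≥ 3m·t₀ > 2δ + 3G + e − 1` by `X < 3m·(X/(3m)) + 3m`.) The multiple `t₀` is
CONDUCTOR-TYPE / depth: `t₀ ≤ (δ + G + e − 1)/m + 1`. **In the recovered-fraction currency the class «slice» has exponent `−∞` beyond `t₀`: it is
identically zero, not merely `O(t⁻³)`.** [folklore] -/
theorem slice_eq_one_eventually {e m δ rin rout : ℤ} (he : 0 < e) (hδ : e - 1 ≤ δ) (hio : rout ≤ rin) (hm : 1 ≤ m) {t : ℤ}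
    (ht : (2 * δ + 3 * (rin - rout) + (e - 1)) / (3 * m) + 1 ≤ t) {j : ℤ} (hj : 2 ≤ j) : ¬ HullCellδ e (t * m) j δ rin rout := by
  set X : ℤ := 2 * δ + 3 * (rin - rout) + (e - 1) with hX
  have h3m : 0 < 3 * m := by omega
  have h1 : X < 3 * m * (X / (3 * m)) + 3 * m := Int.lt_mul_ediv_self_add h3m
  have h2 : 3 * m * (X / (3 * m) + 1) ≤ 3 * m * t := mul_le_mul_of_nonneg_left ht h3m.le
  have hX0 : 0 ≤ X := by
    have : 0 ≤ rin - rout := by omega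
    omega
  have ht0 : 0 ≤ t := by
    have : 0 ≤ X / (3 * m) := Int.ediv_nonneg hX0 h3m.le
    omega
  refine not_hullCellδ_of_two_le_of_lt he hδ hio (by nlinarith) ?_ hj
  nlinarith

/-- **Non-monotonicity in the depth (FLICKER), a genuine bed row**: label-2 licence can come back as the depth grows — the integral-structure gain
`ρ₂ = (4m − 2δ − 3r_in) mod e` is not monotone in `m`. FREY133 datum `2⁵67⁸107·22381 + 5⁴53⁶353⁵ @ l = 13`, place `p = 83` (`e_w = 390`,
`δ = 389`, `R_in = 5`, `R_out = −307`, `m_q = 30`): label `2` is ON at `t ≤ 19 = t_nec`, OFF at `t = 20, 21` (depth `630`), ON again at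
`t = 22` (depth `660`), and OFF for good from `t = 23` (depth `690`; `t_suf = 24`) — so `t₁ = 23` for this place. Hence the tables' extinction multiplier
`t₁ := 1 + (last t with label 2 ON)` is found by a scan below `t_suf`, not by bisection. [folklore] -/
theorem flicker_row :
    ¬ HullCellδ 390 630 2 389 5 (-307) ∧ HullCellδ 390 660 2 389 5 (-307) ∧ ¬ HullCellδ 390 690 2 389 5 (-307) := by
  unfold HullCellδ
  decide

/-! ## §3. The cubic bound for the licensed demand count -/

/-- **CUBIC MASS BOUND.** If `1 ≤ J`, `0 ≤ x` and `(J − 1)·x ≤ A` then `J·(J−1)·(2J+5)·x³ ≤ A·(A + x)·(2A + 7x)`. With `x = t·m` the scaled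
depth and `A = δ + G + e − 1` (§1): `6·S(J_t)·(tm)³ ≤ A(A + tm)(2A + 7tm)`, `S(n) = n(n−1)(2n+5)/6 = Σ_{j≤n}(j²−1)` the licensed demand count
(`RHCellWeights.sum_range_sqSubOne`) — so `S(J_t) ≤ (A³/3)(tm)⁻³(1 + tm/A)(1 + 7tm/(2A))`: **EXPONENT −3** for the slice's kept fraction
`S(J_t)/S(l⋆)` in the regime `tm ≪ A` (`1 ≪ J_t`), linear in `A/(tm)` near extinction, then `0` (§2). (Three factor-wise inequalities
`(J−1)x ≤ A`, `Jx ≤ A + x`, `(2J+5)x ≤ 2A + 7x`, multiplied.) [folklore] -/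
theorem six_sliceDemand_mul_cube_le {J x A : ℤ} (hJ : 1 ≤ J) (hx : 0 ≤ x) (h : (J - 1) * x ≤ A) :
    J * (J - 1) * (2 * J + 5) * x ^ 3 ≤ A * (A + x) * (2 * A + 7 * x) := by
  have hA : 0 ≤ A := le_trans (mul_nonneg (by omega) hx) h
  have h1 : (J - 1) * x ≤ A := h
  have h2 : J * x ≤ A + x := by nlinarith
  have h3 : (2 * J + 5) * x ≤ 2 * A + 7 * x := by nlinarith
  have h0b : 0 ≤ J * x := mul_nonneg (by omega) hx
  have h0c : 0 ≤ (2 * J + 5) * x := mul_nonneg (by omega) hx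
  have h12 : (J - 1) * x * (J * x) ≤ A * (A + x) := mul_le_mul h1 h2 h0b hA
  have h123 : (J - 1) * x * (J * x) * ((2 * J + 5) * x) ≤ A * (A + x) * (2 * A + 7 * x) :=
    mul_le_mul h12 h3 h0c (mul_nonneg hA (by omega))
  have hring : (J - 1) * x * (J * x) * ((2 * J + 5) * x) = J * (J - 1) * (2 * J + 5) * x ^ 3 := by ring
  linarith [hring]

/-- **The cubic bound AT THE CELL**: a licensed label `J ≥ 1` at the scaled depth `t·m` (`t ≥ 1`, `m ≥ 0`) has
`J(J−1)(2J+5)·(tm)³ ≤ A(A + tm)(2A + 7tm)`, `A = δ + (r_in − r_out) + (e − 1)` — §1 and `six_sliceDemand_mul_cube_le` composed. Read with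
`J = J_t` the boundary: the kept demand fraction of the place is `≤ A(A + tm)(2A + 7tm)/((tm)³·l⋆(l⋆−1)(2l⋆+5))`. [folklore] -/
theorem six_sliceDemand_mul_cube_le_of_hullCellδ {e m t J δ rin rout : ℤ} (he : 0 < e) (hδ : e - 1 ≤ δ) (hio : rout ≤ rin) (hm : 0 ≤ m)
    (ht : 1 ≤ t) (hJ : 1 ≤ J) (h : HullCellδ e (t * m) J δ rin rout) :
    J * (J - 1) * (2 * J + 5) * (t * m) ^ 3 ≤
      (δ + (rin - rout) + (e - 1)) * ((δ + (rin - rout) + (e - 1)) + t * m) * (2 * (δ + (rin - rout) + (e - 1)) + 7 * (t * m)) :=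
  six_sliceDemand_mul_cube_le hJ (by nlinarith) (sub_one_mul_le_of_hullCellδ he hδ hio hJ h)

/-! ## §3b. The ∀-CONSTANT (RULING R81 (G1), abc-iut-rh3-tst-1 GUARD 1): `S(J_t) ≤ 3·(A/(t·m))³` at EVERY dilation `t ≥ 1` -/

/-- **`6·S(J) ≤ 18·(J − 1)³` for `J ≥ 2`**: `J(2J+5) ≤ 18(J−1)²` since `18(J−1)² − J(2J+5) = (J − 2)(16J − 9) ≥ 0`; equality at `J = 2`
(`S(2) = 3`). [folklore] -/
theorem six_sliceDemand_le_eighteen_cube {J : ℤ} (hJ : 2 ≤ J) : J * (J - 1) * (2 * J + 5) ≤ 18 * (J - 1) ^ 3 := by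
  have h1 : J * (2 * J + 5) ≤ 18 * (J - 1) ^ 2 := by nlinarith
  have h2 : 0 ≤ J - 1 := by omega
  nlinarith

/-- **THE CERTIFIED ∀-CONSTANT for the slice** (R-H RULING R81 (G1); abc-iut-rh3-tst-1 D2-REFUTE-1 GUARD 1, 12:37:57Z: the continuum `≍`-constant
`K_T = Σ_w ω_w θ_w³` is exceeded by `sup_s s³·μ_slice(s)` by `1.7–6.9×` on 694/694 data, so an `ExponentAtMost μ_slice (−3) C` instance must cite a
`∀ s ≥ 1` constant — this one): if `1 ≤ J`, `0 ≤ x` and `(J − 1)·x ≤ A` then **`J(J−1)(2J+5)·x³ ≤ 18·A³`, i.e. `S(J) ≤ 3·(A/x)³`** (case `J = 1`: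
`0 ≤ 18A³`; case `J ≥ 2`: `6S(J) ≤ 18(J−1)³` and `(J−1)x ≤ A` cubed). With `x = t·m`, `A = A_w`, summed over places with the weights `ω_w`:
`μ_slice(t) ≤ C_A·t⁻³` for EVERY integer `t ≥ 1`, `C_A := 3·Σ_w ω_w·(A_w/m_q,w)³/S(l⋆)` — tst-1's constant (sup/C_A ≤ 0.49 on 694/694 data, 0 violations).
[folklore] -/
theorem six_sliceDemand_mul_cube_le_cube {J x A : ℤ} (hJ : 1 ≤ J) (hx : 0 ≤ x) (h : (J - 1) * x ≤ A) :
    J * (J - 1) * (2 * J + 5) * x ^ 3 ≤ 18 * A ^ 3 := by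
  have hA : 0 ≤ A := le_trans (mul_nonneg (by omega) hx) h
  rcases eq_or_lt_of_le hJ with rfl | hJ2
  · norm_num; positivity
  · have hJ2' : 2 ≤ J := by omega
    have h1 := six_sliceDemand_le_eighteen_cube hJ2'
    have h0 : 0 ≤ (J - 1) * x := mul_nonneg (by omega) hx
    have hcube : ((J - 1) * x) ^ 3 ≤ A ^ 3 := pow_le_pow_left₀ h0 h 3
    have hx3 : 0 ≤ x ^ 3 := pow_nonneg hx 3
    calc J * (J - 1) * (2 * J + 5) * x ^ 3 ≤ 18 * (J - 1) ^ 3 * x ^ 3 := mul_le_mul_of_nonneg_right h1 hx3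
      _ = 18 * ((J - 1) * x) ^ 3 := by ring
      _ ≤ 18 * A ^ 3 := by nlinarith

/-- **The ∀-constant AT THE CELL**: a licensed label `J ≥ 1` at the scaled depth `t·m` (`t ≥ 1`, `m ≥ 0`) has `J(J−1)(2J+5)·(tm)³ ≤ 18·A³`,
`A = δ + (r_in − r_out) + (e − 1)` — so at every place and EVERY dilation `t ≥ 1` the licensed demand count obeys `S(J_t) ≤ 3A³·(tm)⁻³` with a
conductor-type numerator: the `PowerBoundFrom`/`ExponentAtMost (−3)` face of the class «slice» (typers rh2-w-2 / rh2-T-1). [folklore] -/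
theorem six_sliceDemand_mul_cube_le_cube_of_hullCellδ {e m t J δ rin rout : ℤ} (he : 0 < e) (hδ : e - 1 ≤ δ) (hio : rout ≤ rin) (hm : 0 ≤ m)
    (ht : 1 ≤ t) (hJ : 1 ≤ J) (h : HullCellδ e (t * m) J δ rin rout) :
    J * (J - 1) * (2 * J + 5) * (t * m) ^ 3 ≤ 18 * (δ + (rin - rout) + (e - 1)) ^ 3 :=
  six_sliceDemand_mul_cube_le_cube hJ (by nlinarith) (sub_one_mul_le_of_hullCellδ he hδ hio hJ h)

/-! ## §4. Bed witness rows (R-W WINDOW-TABLE v4.11 integers at scaled depths), by `decide` -/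

/-- **HEX `λ₈ @ l = 11`, `p = 7`** (`e_w = 165`, `δ = 164`, `R_in = 28`, `R_out = −281`, `m_q = 120`; `A = 637`, `b = 473`, `l⋆ = 5`): boundary
`J = 4, 2, 2, 1` at `t = 1, 2, 3, 4` (depths `120, 240, 360, 480`) — label `2` ON at `t = 3`, OFF at `t = 4 = t_suf` (`t_nec = 3`): the place's
slice is extinct from `4×` the tabulated height. [folklore] -/
theorem hex_lambda8_l11_staircase :
    (HullCellδ 165 120 4 164 28 (-281) ∧ ¬ HullCellδ 165 120 5 164 28 (-281)) ∧
      (HullCellδ 165 240 2 164 28 (-281) ∧ ¬ HullCellδ 165 240 3 164 28 (-281)) ∧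
        (HullCellδ 165 360 2 164 28 (-281) ∧ ¬ HullCellδ 165 360 3 164 28 (-281)) ∧
          ¬ HullCellδ 165 480 2 164 28 (-281) := by
  unfold HullCellδ
  decide

/-- **FREY `2⁵67⁸107·22381 + 5⁴53⁶353⁵ @ l = 13`, `p = 3` WILD** (`e_w = 390`, `δ = 779`, `R_in = 196`, `R_out = −1707`, `m_q = 660`; `A = 3071`,
`b = 2682`, `l⋆ = 6`): `J = 4, 2, 2, 1` at `t = 1, 2, 3, 4` — extinct from `t = 4` (`t_nec = 3`, `t_suf = 4`). [folklore] -/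
theorem frey_p3_wild_l13_staircase :
    (HullCellδ 390 660 4 779 196 (-1707) ∧ ¬ HullCellδ 390 660 5 779 196 (-1707)) ∧
      (HullCellδ 390 1320 2 779 196 (-1707) ∧ ¬ HullCellδ 390 1320 3 779 196 (-1707)) ∧
        (HullCellδ 390 1980 2 779 196 (-1707) ∧ ¬ HullCellδ 390 1980 3 779 196 (-1707)) ∧
          ¬ HullCellδ 390 2640 2 779 196 (-1707) := by
  unfold HullCellδ
  decide

/-- **Same datum, `p = 53`** (`e_w = 65`, `δ = 64`, `R_in = 2`, `R_out = −12`, `m_q = 30`; `A = 142`, `b = 78`): `J = 3, 2, 1` at `t = 1, 2, 3` —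
extinct from `t = 3` (`t_nec = 1`, `t_suf = 3`). [folklore] -/
theorem frey_p53_l13_staircase :
    (HullCellδ 65 30 3 64 2 (-12) ∧ ¬ HullCellδ 65 30 4 64 2 (-12)) ∧
      (HullCellδ 65 60 2 64 2 (-12) ∧ ¬ HullCellδ 65 60 3 64 2 (-12)) ∧
        ¬ HullCellδ 65 90 2 64 2 (-12) := by
  unfold HullCellδ
  decide

end Summit.ABC.IUTFork.Repair.RH.HullCellSliceHeightScaling
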